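import Mathlib.CategoryTheory.Category.ULift
import Literature.IUT.HodgeTheaters.PMBaseKit
import HarnessLib

/-!
# Universe lift of a §6 base kit: `PMBaseKit.ulift : PMBaseKit.{u} l → PMBaseKit.{max u w} l`

S. Mochizuki, *Inter-universal Teichmüller theory I*, kurims manuscript (May 2020), Definition 6.1 (ii)–(vii)
pp. 156–159 ([IUTchI] Def 6.1 p.156) [claim: Mochizuki2012, status: disputed] (D-0012 claim key; this file is
UNIVERSE PLUMBING for the cell's hypothesis structure `PMBaseKit` of abc-iut-L5-t4 — nothing of the series is asserted
and no side is taken on [IUTchIII] Cor. 3.12).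

## Why this file exists (the U1 adapter, GAP G-w4d056-3 memo of abc-iut-L5-t5 g4)

abc-iut-L5-t5's construction `BaseThetaDatum.S5Local.ofDatum` / `IsoKit.ofDatum` (`KitS5LocalOfDatum.lean`,
`KitIsoKitOfDatum.lean`) — the ΘNF-side §5/§6 kit READ OFF abc-iut-L5-t3's Definition 5.5 typing — elaborates only over a
base kit in a SUCCESSOR universe `PMBaseKit.{u+1}` (abc-iut-L5-t3's `ThetaNFHodgeTheater : Type (max 1 u)` must fill the
slot `ThetaNFHT : Type U`).  Every CLOSED kit of the tree (abc-iut-L5-t4's `toyKit`, abc-iut-w5-d217's `thicken`,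
abc-iut-L5-t17's `toyKitBad`) is pinned to `PMBaseKit.{0}`, and the arithmetic constructor of record
`InitialThetaData.ofArith` pins `F̄ := AlgebraicClosure F : Type 0` for a concrete number field — so the kits one can
actually build live in universe `0`, where `ofDatum` cannot be instantiated (kernel: «Type mismatch … PMBaseKit.S5Local.{?u+1}
… expected PMBaseKit.S5Local.{0}»).  This file supplies the generic adapter:

* `PMBaseKit.ulift.{u, w} K : PMBaseKit.{max u w} l` — the SAME kit with every ambient category replaced by Mathlib's
  small model `AsSmall.{w}` (objects and morphisms `ULift`ed) and every label type `ULift`ed; all ≈ 35 laws of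
  abc-iut-L5-t4's structure transported along `AsSmall.up/down` and `Equiv.ulift` (kernel-checked, no new hypothesis);
* the transports it rests on: `FlPMGroup.comap` / `FlPMTorsor.comap` (an `𝔽_l^±`-group / -torsor structure pulled back
  along a bijection, [IUTchI] Def 6.1 (i)) with `FlPMTorsor.mem_autPM_comap_iff`, and the `AsSmall` iso dictionary
  `PMBaseKit.ULiftAux.downIso` / `upIso`;
* rfl-level readings (`ulift_V`, `ulift_bad`, `ulift_model`, `isLocal_ulift_iff`, …) for consumers.

Consumers: abc-iut-L5-t5's NV witness firing `S5Local.ofDatum` at universe `1` (companion file), and — the same shape —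
any kit ASSEMBLED at universe `0` from `InitialThetaData.ofArith` (D13, abc-iut-L5-t4/t3) that must feed `ofDatum`
(option R2 of the U1 memo; R0b = `AsSmall`-wrapping at assembly time is the per-slot form of the same transport).
Plumbing only; every `theorem` is kernel-checked; typed ≠ proved elsewhere.
-/

namespace Literature.IUT.HodgeTheaters

open CategoryTheory

universe u w

/-! ### Transport of `𝔽_l^±`-group / -torsor structures along a bijection -/

namespace FlPMGroup

variable {l : ℕ} {E E' : Type*}

/-- The `𝔽_l^±`-group structure on `E'` PULLED BACK along a bijection `e : E' ≃ E` from one on `E`: a bijection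
`E' ≃ 𝔽_l` is a chart iff its composite with `e⁻¹` is a chart of `E` ("any set `E` equipped with a `{±1}`-orbit of
bijections `E ≃ 𝔽_l`", [IUTchI] Def 6.1 (i) p. 155; transport of structure).
([IUTchI] Def 6.1 (i) p.155) [claim: Mochizuki2012, status: disputed] -/
def comap (S : FlPMGroup l E) (e : E' ≃ E) : FlPMGroup l E' where
  charts := {f | e.symm.trans f ∈ S.charts}
  nonempty := ⟨e.trans S.nonempty.some, by
    change e.symm.trans (e.trans S.nonempty.some) ∈ S.charts
    rw [← Equiv.trans_assoc, Equiv.symm_trans_self, Equiv.refl_trans]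
    exact S.nonempty.some_mem⟩
  eq_orbit := by
    intro f hf
    ext g
    change e.symm.trans g ∈ S.charts ↔ g ∈ Set.range fun ε : ℤˣ => f.trans (signPerm l ε)
    rw [S.eq_orbit _ hf]
    constructor
    · rintro ⟨ε, hε⟩
      refine ⟨ε, ?_⟩
      have h := congrArg (fun h => e.trans h) hε
      simpa only [← Equiv.trans_assoc, Equiv.self_trans_symm, Equiv.refl_trans] using h
    · rintro ⟨ε, rfl⟩
      exact ⟨ε, Equiv.trans_assoc _ _ _⟩

/-- Membership in the charts of the pulled-back structure (definitional). ([IUTchI] Def 6.1 (i) p.155) [claim: Mochizuki2012, status: disputed] -/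
theorem mem_comap_charts_iff (S : FlPMGroup l E) (e : E' ≃ E) (f : E' ≃ ZMod l) :
    f ∈ (S.comap e).charts ↔ e.symm.trans f ∈ S.charts := Iff.rfl

end FlPMGroup

namespace FlPMTorsor

variable {l : ℕ} {T T' : Type*}

/-- The `𝔽_l^±`-torsor structure on `T'` PULLED BACK along a bijection `e : T' ≃ T` from one on `T`: a bijection
`T' ≃ 𝔽_l` is a chart iff its composite with `e⁻¹` is a chart of `T` ([IUTchI] Def 6.1 (i) p. 155; transport of
structure). ([IUTchI] Def 6.1 (i) p.155) [claim: Mochizuki2012, status: disputed] -/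
def comap (S : FlPMTorsor l T) (e : T' ≃ T) : FlPMTorsor l T' where
  charts := {f | e.symm.trans f ∈ S.charts}
  nonempty := ⟨e.trans S.nonempty.some, by
    change e.symm.trans (e.trans S.nonempty.some) ∈ S.charts
    rw [← Equiv.trans_assoc, Equiv.symm_trans_self, Equiv.refl_trans]
    exact S.nonempty.some_mem⟩
  eq_orbit := by
    intro f hf
    ext g
    change e.symm.trans g ∈ S.charts ↔ g ∈ Set.range fun g : FlPM l => f.trans (FlPM.toPerm l g)
    rw [S.eq_orbit _ hf]
    constructor
    · rintro ⟨ε, hε⟩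
      refine ⟨ε, ?_⟩
      have h := congrArg (fun h => e.trans h) hε
      simpa only [← Equiv.trans_assoc, Equiv.self_trans_symm, Equiv.refl_trans] using h
    · rintro ⟨ε, rfl⟩
      exact ⟨ε, Equiv.trans_assoc _ _ _⟩

/-- Membership in the charts of the pulled-back torsor structure (definitional). ([IUTchI] Def 6.1 (i) p.155) [claim: Mochizuki2012, status: disputed] -/
theorem mem_comap_charts_iff (S : FlPMTorsor l T) (e : T' ≃ T) (f : T' ≃ ZMod l) :
    f ∈ (S.comap e).charts ↔ e.symm.trans f ∈ S.charts := Iff.rfl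

/-- `Aut_±` of the pulled-back torsor structure is the conjugate of `Aut_±` of the original one: a permutation `σ` of
`T'` lies in `Aut_±(T')` iff `e ∘ σ ∘ e⁻¹` lies in `Aut_±(T)` ([IUTchI] Def 6.1 (i) p. 155).
([IUTchI] Def 6.1 (i) p.155) [claim: Mochizuki2012, status: disputed] -/
theorem mem_autPM_comap_iff (S : FlPMTorsor l T) (e : T' ≃ T) (σ : Equiv.Perm T') :
    σ ∈ (S.comap e).autPM ↔ (e.symm.trans (σ.trans e) : Equiv.Perm T) ∈ S.autPM := by
  rw [FlPMTorsor.mem_autPM_iff, FlPMTorsor.mem_autPM_iff]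
  constructor
  · intro h c hc
    obtain ⟨g, hg⟩ := h (e.trans c) (by
      change e.symm.trans (e.trans c) ∈ S.charts
      rwa [← Equiv.trans_assoc, Equiv.symm_trans_self, Equiv.refl_trans])
    exact ⟨g, fun t => by simpa using hg (e.symm t)⟩
  · intro h f hf
    obtain ⟨g, hg⟩ := h (e.symm.trans f) hf
    exact ⟨g, fun t => by simpa using hg (e t)⟩

end FlPMTorsor

/-! ### The `AsSmall` isomorphism dictionary -/

namespace PMBaseKit.ULiftAux

variable {C : Type u} [Category.{u} C]

/-- An isomorphism of the small model `AsSmall.{w} C` read in `C` (`AsSmall.down` on isomorphisms).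
(universe plumbing) ([IUTchI] Def 6.1 p.156) [claim: Mochizuki2012, status: disputed] -/
abbrev downIso {X Y : AsSmall.{w} C} (φ : X ≅ Y) : AsSmall.down.obj X ≅ AsSmall.down.obj Y := AsSmall.down.mapIso φ

/-- An isomorphism of `C` between underlying objects read in the small model `AsSmall.{w} C`.
(universe plumbing) ([IUTchI] Def 6.1 p.156) [claim: Mochizuki2012, status: disputed] -/
def upIso {X Y : AsSmall.{w} C} (e : AsSmall.down.obj X ≅ AsSmall.down.obj Y) : X ≅ Y where
  hom := ULift.up e.hom
  inv := ULift.up e.inv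
  hom_inv_id := congrArg ULift.up e.hom_inv_id
  inv_hom_id := congrArg ULift.up e.inv_hom_id

/-- `downIso` of `upIso` is the identity. (universe plumbing) ([IUTchI] Def 6.1 p.156) [claim: Mochizuki2012, status: disputed] -/
@[simp] theorem downIso_upIso {X Y : AsSmall.{w} C} (e : AsSmall.down.obj X ≅ AsSmall.down.obj Y) :
    downIso (upIso e) = e := Iso.ext rfl

/-- `upIso` of `downIso` is the identity. (universe plumbing) ([IUTchI] Def 6.1 p.156) [claim: Mochizuki2012, status: disputed] -/
@[simp] theorem upIso_downIso {X Y : AsSmall.{w} C} (φ : X ≅ Y) : upIso (downIso φ) = φ := Iso.ext rfl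

/-- `downIso` of the identity. (universe plumbing) ([IUTchI] Def 6.1 p.156) [claim: Mochizuki2012, status: disputed] -/
theorem downIso_refl (X : AsSmall.{w} C) : downIso (Iso.refl X) = Iso.refl (AsSmall.down.obj X) := Iso.ext rfl

/-- `downIso` of a composite. (universe plumbing) ([IUTchI] Def 6.1 p.156) [claim: Mochizuki2012, status: disputed] -/
theorem downIso_trans {X Y Z : AsSmall.{w} C} (φ : X ≅ Y) (ψ : Y ≅ Z) :
    downIso (φ ≪≫ ψ) = downIso φ ≪≫ downIso ψ := Iso.ext rfl

/-- `downIso` on automorphisms, as a group homomorphism `Aut X →* Aut X↓` (`f * g = g ≫ f` on both sides).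
(universe plumbing) ([IUTchI] Def 6.1 p.156) [claim: Mochizuki2012, status: disputed] -/
def autDown (X : AsSmall.{w} C) : Aut X →* Aut (AsSmall.down.obj X) where
  toFun := downIso
  map_one' := downIso_refl X
  map_mul' φ ψ := downIso_trans ψ φ

/-- `autDown` is `downIso`. (universe plumbing) ([IUTchI] Def 6.1 p.156) [claim: Mochizuki2012, status: disputed] -/
@[simp] theorem autDown_apply (X : AsSmall.{w} C) (φ : Aut X) : autDown X φ = downIso φ := rfl

end PMBaseKit.ULiftAux

/-! ### The lift -/

namespace PMBaseKit

open ULiftAux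

variable {l : ℕ}

/-- **Universe lift of a base kit.** `K.ulift : PMBaseKit.{max u w} l` is the base kit `K : PMBaseKit.{u} l` with:
places, bad and archimedean places unchanged; ambient category at `v` the small model `AsSmall.{w} (K.Amb v)` (objects and
morphisms `ULift`ed — Mathlib's `AsSmall`, equivalent to `K.Amb v`); model `⟨𝒟_v⟩`; `†𝒟_v^±`, `†𝒟_v → †𝒟_v^±` lifted
componentwise; `LabCusp^±(†𝒟_v) := ULift (LabCusp^±(†𝒟_v↓))` with the `𝔽_l^±`-group structure pulled back along
`Equiv.ulift`; global objects `AsSmall.{w} K.Glob`, `LabCusp^±(†𝒟^{⊚±})` lifted likewise with its `𝔽_l^±`-torsor structure,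
`Aut ↠ 𝔽_l^⋇` through `Aut ⟨G⟩ → Aut G`; `atV v := down ⋙ K.atV v ⋙ up`, `φ^{Θell}_{•,v} := ⟨φ^{Θell}_{•,v}⟩`, labels of
morphisms read through `down`.  Every law of [IUTchI] Def 6.1 (ii)–(vii) as packaged by abc-iut-L5-t4 TRANSFERS (kernel).
([IUTchI] Def 6.1 p.156) [claim: Mochizuki2012, status: disputed] -/
noncomputable def ulift (K : PMBaseKit.{u} l) : PMBaseKit.{max u w} l where
  V := K.V
  bad := K.bad
  arc := K.arc
  Amb x := AsSmall.{w} (K.Amb x)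
  model x := AsSmall.up.obj (K.model x)
  pmObj x X := AsSmall.up.obj (K.pmObj x (AsSmall.down.obj X))
  toPM x X := ULift.up (K.toPM x (AsSmall.down.obj X))
  LabCuspPM x X := ULift.{w} (K.LabCuspPM x (AsSmall.down.obj X))
  labPM x X hX := (K.labPM x (AsSmall.down.obj X) ⟨downIso hX.some⟩).comap Equiv.ulift
  labMap x := fun φ => Equiv.ulift.trans ((K.labMap x (downIso φ)).trans Equiv.ulift.symm)
  labMap_refl x X := by
    rw [downIso_refl, K.labMap_refl, Equiv.refl_trans]
    exact Equiv.self_trans_symm _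
  labMap_trans x := fun φ ψ => by
    rw [downIso_trans, K.labMap_trans]
    rfl
  labMap_charts x := fun {X Y} hX hY φ e he => by
    rw [FlPMGroup.mem_comap_charts_iff] at he ⊢
    have h := K.labMap_charts x ⟨downIso hX.some⟩ ⟨downIso hY.some⟩ (downIso φ) _ he
    convert h using 1
    exact Equiv.ext fun _ => rfl
  exists_negative x X hX := by
    obtain ⟨α, hα⟩ := K.exists_negative x (AsSmall.down.obj X) ⟨downIso hX.some⟩
    refine ⟨upIso α, fun h => hα ?_⟩
    ext c
    have hc := congrArg (fun f => (f ⟨c⟩).down) h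
    simpa using hc
  Glob := AsSmall.{w} K.Glob
  gModel := AsSmall.up.obj K.gModel
  gIso G := ⟨upIso (K.gIso (AsSmall.down.obj G)).some⟩
  GLab G := ULift.{w} (K.GLab (AsSmall.down.obj G))
  gLabMap := fun φ => Equiv.ulift.trans ((K.gLabMap (downIso φ)).trans Equiv.ulift.symm)
  gLabMap_refl G := by
    rw [downIso_refl, K.gLabMap_refl, Equiv.refl_trans]
    exact Equiv.self_trans_symm _
  gLabMap_trans := fun φ ψ => by
    rw [downIso_trans, K.gLabMap_trans]
    rfl
  toFlStar G := (K.toFlStar (AsSmall.down.obj G)).comp (autDown G)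
  toFlStar_surjective G := fun s => by
    obtain ⟨α, hα⟩ := K.toFlStar_surjective (AsSmall.down.obj G) s
    refine ⟨upIso α, ?_⟩
    show K.toFlStar _ (downIso (upIso α)) = s
    rw [downIso_upIso]
    exact hα
  gLabT := K.gLabT.comap Equiv.ulift
  gChart₀ := Equiv.ulift.trans K.gChart₀
  gChart₀_mem := by
    show Equiv.ulift.symm.trans (Equiv.ulift.trans K.gChart₀) ∈ K.gLabT.charts
    convert K.gChart₀_mem using 1
    exact Equiv.ext fun _ => rfl
  autCsp_le G α h := by
    show K.toFlStar _ (downIso α) = 1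
    refine K.autCsp_le _ (downIso α) ?_
    ext c
    have hc := congrArg (fun f => (f ⟨c⟩).down) h
    simpa using hc
  gLab_range σ := by
    rw [FlPMTorsor.mem_autPM_comap_iff, K.gLab_range]
    constructor
    · rintro ⟨α, h1, h2⟩
      let G₀ : AsSmall.{w} K.Glob := AsSmall.up.obj K.gModel
      refine ⟨upIso (X := G₀) (Y := G₀) α, ?_, ?_⟩
      · show K.toFlStar _ (downIso (upIso (X := G₀) (Y := G₀) α)) = 1
        rw [downIso_upIso]
        exact h1
      · show Equiv.ulift.trans ((K.gLabMap (downIso (upIso (X := G₀) (Y := G₀) α))).trans Equiv.ulift.symm) = σ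
        rw [downIso_upIso]
        exact Equiv.ext fun c => congrArg ULift.up (congrArg (fun f => f c.down) h2)
    · rintro ⟨α, h1, h2⟩
      refine ⟨downIso α, h1, ?_⟩
      rw [← h2]
      rfl
  atV x := AsSmall.down ⋙ K.atV x ⋙ AsSmall.up
  phiEll x := ULift.up (K.phiEll x)
  labOfHom x := fun f c => ULift.up (K.labOfHom x f.down c.down)
  labOfHom_pre x := fun φ f => by
    funext c
    exact congrArg ULift.up (congrFun (K.labOfHom_pre x (downIso φ) f.down) c.down)
  labOfHom_post x := fun f ψ => by
    funext c
    exact congrArg ULift.up (congrFun (K.labOfHom_post x f.down (downIso ψ)) c.down)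
  labOfHom_phiEll_bijective x :=
    (Equiv.ulift.symm.bijective.comp (K.labOfHom_phiEll_bijective x)).comp Equiv.ulift.bijective
  labOfHom_phiEll_charts x e he := by
    rw [FlPMGroup.mem_comap_charts_iff] at he
    have h := K.labOfHom_phiEll_charts x _ he
    show Equiv.ulift.symm.trans ((Equiv.ofBijective (fun c : ULift.{w} (K.LabCuspPM x (K.model x)) =>
        ULift.up.{w} (K.labOfHom x (K.phiEll x) c.down))
      ((Equiv.ulift.symm.bijective.comp (K.labOfHom_phiEll_bijective x)).comp Equiv.ulift.bijective)).symm.trans e) ∈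
        K.gLabT.charts
    have hB : Equiv.ofBijective (fun c : ULift.{w} (K.LabCuspPM x (K.model x)) =>
          ULift.up.{w} (K.labOfHom x (K.phiEll x) c.down))
          ((Equiv.ulift.symm.bijective.comp (K.labOfHom_phiEll_bijective x)).comp Equiv.ulift.bijective) =
        Equiv.ulift.trans ((Equiv.ofBijective _ (K.labOfHom_phiEll_bijective x)).trans Equiv.ulift.symm) :=
      Equiv.ext fun _ => rfl
    rw [hB]
    convert h using 1
    exact Equiv.ext fun _ => rfl

variable (K : PMBaseKit.{u} l)

/-! ### Readings -/

/-- The lifted kit has the same places. ([IUTchI] Def 6.1 p.156) [claim: Mochizuki2012, status: disputed] -/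
theorem ulift_V : (ulift.{u, w} K).V = K.V := rfl

/-- The lifted kit has the same bad places. ([IUTchI] Def 6.1 p.156) [claim: Mochizuki2012, status: disputed] -/
theorem ulift_bad : (ulift.{u, w} K).bad = K.bad := rfl

/-- The lifted kit has the same archimedean places. ([IUTchI] Def 6.1 p.156) [claim: Mochizuki2012, status: disputed] -/
theorem ulift_arc : (ulift.{u, w} K).arc = K.arc := rfl

/-- The model of the lifted kit is `⟨𝒟_v⟩`. ([IUTchI] Def 6.1 p.156) [claim: Mochizuki2012, status: disputed] -/
theorem ulift_model (x : K.V) : (ulift.{u, w} K).model x = AsSmall.up.obj (K.model x) := rfl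

/-- The global model of the lifted kit is `⟨𝒟^{⊚±}⟩`. ([IUTchI] Def 6.1 (v) p.158) [claim: Mochizuki2012, status: disputed] -/
theorem ulift_gModel : (ulift.{u, w} K).gModel = AsSmall.up.obj K.gModel := rfl

/-- `φ^{Θell}_{•,v}` of the lifted kit is the lift of `φ^{Θell}_{•,v}`. ([IUTchI] Ex 6.3 (i) p.161) [claim: Mochizuki2012, status: disputed] -/
theorem ulift_phiEll_down (x : K.V) : ((ulift.{u, w} K).phiEll x).down = K.phiEll x := rfl

/-- `Aut ↠ 𝔽_l^⋇` of the lifted kit is that of `K` read through `down`. ([IUTchI] Def 6.1 (v) p.158) [claim: Mochizuki2012, status: disputed] -/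
theorem ulift_toFlStar (G : (ulift.{u, w} K).Glob) (α : Aut G) :
    (ulift.{u, w} K).toFlStar G α = K.toFlStar (AsSmall.down.obj G) (downIso α) := rfl

/-- The label map of a morphism to a global object, in the lifted kit, is that of `K` read through `down`.
([IUTchI] Prop 6.5 (i) p.163) [claim: Mochizuki2012, status: disputed] -/
theorem ulift_labOfHom_down (x : K.V) {X : (ulift.{u, w} K).Amb x} {G : (ulift.{u, w} K).Glob}
    (f : X ⟶ ((ulift.{u, w} K).atV x).obj G) (c : (ulift.{u, w} K).LabCuspPM x X) :
    ((ulift.{u, w} K).labOfHom x f c).down = K.labOfHom x f.down c.down := rfl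

/-- An object of the lifted ambient category is an isomorph of the lifted model iff its underlying object is an isomorph
of the model (Def 4.1 (i) "`†𝒟_v ⥲ 𝒟_v`"). ([IUTchI] Def 4.1 (i) p.95) [claim: Mochizuki2012, status: disputed] -/
theorem isLocal_ulift_iff (x : K.V) (X : (ulift.{u, w} K).Amb x) :
    (ulift.{u, w} K).IsLocal x X ↔ K.IsLocal x (AsSmall.down.obj X) :=
  ⟨fun h => ⟨downIso h.some⟩, fun h => ⟨upIso h.some⟩⟩

/-- **KIT-RULE transfer**: a base kit in universe `u` yields one in every universe `max u w` — in particular the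
universe-`0` kits of the tree yield universe-`1` kits, over which abc-iut-L5-t5's `S5Local.ofDatum` elaborates.
([IUTchI] Def 6.1 p.156) [claim: Mochizuki2012, status: disputed] -/
theorem nonempty_ulift (h : Nonempty (PMBaseKit.{u} l)) : Nonempty (PMBaseKit.{max u w} l) :=
  ⟨ulift.{u, w} h.some⟩

end PMBaseKit

end Literature.IUT.HodgeTheaters
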